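import Literature.NumberTheory.QuadraticFields.IndivisibleClassNumberSplitPrimes
import Literature.NumberTheory.EllipticCurves.HeegnerHypothesisKroneckerProofs
import Literature.NumberTheory.EllipticCurves.HeegnerPointsImaginaryQuadraticProofs
import Literature.NumberTheory.EllipticCurves.Rank1Residual.Predicates
import Mathlib.Tactic.NormNum.LegendreSymbol
import HarnessLib

/-!
# Route BiquadraticEisensteinDescent — KS rung: the class-number half of `HeegnerFieldSupplyCMInertBadAdm`
# (item stmt-BirchSwinnertonDyer-20198) for ODD conductor, from Beckwith–Raum–Richter 2024 Thm 1 BY NAME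

The crux KS of the route asks, for every CM curve `W/ℚ` of analytic rank `1` and every prime `p ≥ 5`
of inert-bad type, for ONE imaginary quadratic `K′` with `|d_K′| > 4`, the Heegner hypothesis for
`N_W`, `L(W^(d_K′), 1) ≠ 0` and `p ∤ h(L)` for the biquadratic `L = K_CM·K′`. The SIMULTANEOUS
prescription (twist non-vanishing × class-number indivisibility) is not in print; this file lands
the rung that IS: the class-number half in the `K′`-form for ODD `N_W` —

* `four_lt_natAbs_discr_of_satisfiesHeegnerHypothesis_twentyOne` — an imaginary quadratic field in
  which `3` and `7` split has `|d_K| > 4` (`3` split ⇒ `3 ∤ d_K` ⇒ `d_K ≠ −3`; `7` split ⇒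
  `(d_K/7) = 1`, while `(−4/7) = −1` ⇒ `d_K ≠ −4`; and `|d_K| ≥ 3` for every quadratic field,
  Mathlib `NumberField.abs_discr_gt_two`);
* `exists_heegnerField_four_lt_natAbs_discr_not_dvd_classNumber` — GRANTED Beckwith–Raum–Richter
  IMRN 2024 Thm 1 (the tree's named fact
  `BeckwithRaumRichter2024.thm1_exists_imaginaryQuadratic_split_not_dvd_classNumber`, antecedent):
  for every prime `ℓ` and every ODD `N` there is an imaginary quadratic `K` with `|d_K| > 4`, the
  Heegner hypothesis for `N` and `ℓ ∤ h_K` (Thm 1 with `S₊ = primeFactors (21·N)`);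
* `ksRung_oddConductor` — the same dressed in the binders of KS (signature of the route author's
  sketch HOME/bsd-wall-cm/g5/KSRungOdd.lean, planner bsd-wall-cm g5, 2026-08-27): for `W` CM of
  analytic rank `1`, `p ≥ 5` inert-bad and `N_W` odd, `∃ K′` imaginary quadratic with `4 < |d_K′|`,
  `SatisfiesHeegnerHypothesis N_W K′` (so `p ∣ N_W` splits) and `p ∤ h(K′)`.

HONEST FRAMING: THEOREMS ONLY (0 definitions, 0 named facts, 0 `sorry`). Every statement here is an
IMPLICATION whose antecedent is the published input BRR24 Thm 1 (a `def … : Prop` of the Literature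
file, unproved in the tree); proving them asserts nothing about that input. NOT covered (and said so):
even `N_W` (Thm 1 prescribes splitting at ODD primes only), the twist non-vanishing conjunct of KS,
and the biquadratic class number `h(K_CM·K′)` as typed. A helper `--supports` KS; it closes nothing.
Prover seat bsd-wall-bed-p2 (g5), 2026-08-27.

References: [BeckwithRaumRichter2024] O. Beckwith, M. Raum, O. Richter, IMRN 2024:16, 11582–11596,
Theorem 1; [Darmon2004] Hypothesis 3.9; [Marcus2018] Ch. 3 Thm. 25 (decomposition law).
-/

set_option autoImplicit false

-- D-0017 layout: summit = sub-problem, so `Summit.BirchSwinnertonDyer.BirchSwinnertonDyer.…` is the mandated namespace.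
set_option linter.dupNamespace false

open scoped NumberField
open Literature.NumberTheory.EllipticCurves Literature.NumberTheory.QuadraticFields

namespace Summit.BirchSwinnertonDyer.BirchSwinnertonDyer.Theorems.BiquadraticEisensteinDescentHeegnerFieldSupplyOddRung

/-- **`|d_K| > 4` from the splitting of `3` and `7`.** If `K` is an imaginary quadratic field in which
`3` and `7` split (the Heegner hypothesis for `21`), then `4 < |d_K|`, i.e. `K` is neither `ℚ(√−3)`
nor `ℚ(i)`: a split prime does not divide `d_K` (so `d_K ≠ −3`), `(d_K/7) = 1` whereas
`(−4/7) = −1` (so `d_K ≠ −4`), and `2 < |d_K|` for every quadratic field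
(Mathlib `NumberField.abs_discr_gt_two`). [folklore] -/
theorem four_lt_natAbs_discr_of_satisfiesHeegnerHypothesis_twentyOne {K : Type*} [Field K]
    [NumberField K] (hK : IsImaginaryQuadratic K) (hH : SatisfiesHeegnerHypothesis 21 K) :
    4 < (NumberField.discr K).natAbs := by
  have h3 : ¬ ((3 : ℕ) : ℤ) ∣ NumberField.discr K :=
    Literature.SatisfiesHeegnerHypothesis.not_dvd_discr hK.1 hH Nat.prime_three ⟨7, by norm_num⟩
  have h7 : jacobiSym (NumberField.discr K) 7 = 1 :=
    Literature.SatisfiesHeegnerHypothesis.jacobiSym_discr_eq_one hK.1 hH (by norm_num)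
      ⟨3, by norm_num⟩ (by norm_num)
  have hneg : NumberField.discr K < 0 := hK.discr_neg
  have hgt : 2 < |NumberField.discr K| :=
    NumberField.abs_discr_gt_two (by rw [hK.1]; exact one_lt_two)
  rw [Int.abs_eq_natAbs] at hgt
  have hcast : ((NumberField.discr K).natAbs : ℤ) = -NumberField.discr K :=
    Int.ofNat_natAbs_of_nonpos hneg.le
  by_contra hle
  have hcases : NumberField.discr K = -3 ∨ NumberField.discr K = -4 := by omega
  rcases hcases with e | e
  · exact h3 (by rw [e]; norm_num)
  · rw [e] at h7
    have h74 : jacobiSym (-4) 7 = -1 := by norm_num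
    omega

/-- **Heegner field with `|d_K| > 4` and class number prime to `ℓ`, for ODD level** — GRANTED
Beckwith–Raum–Richter 2024 Thm 1 (antecedent, the tree's named fact): for every prime `ℓ` and every
odd `N` there is an imaginary quadratic field `K` with `4 < |d_K|`, every prime factor of `N` split in
`K`, and `ℓ ∤ h_K`. Proof: Thm 1 with `S₊ = primeFactors (21·N)` (odd), through the tree corollary
`exists_heegnerField_not_dvd_classNumber`; the Heegner hypothesis for `21·N` restricts to `N` and to
`21`, and the latter gives `|d_K| > 4`.
[cite: BeckwithRaumRichter2024, Theorem 1 (IMRN 2024:16 pp. 11582–11583)] -/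
theorem exists_heegnerField_four_lt_natAbs_discr_not_dvd_classNumber
    (h : BeckwithRaumRichter2024.thm1_exists_imaginaryQuadratic_split_not_dvd_classNumber)
    {ℓ : ℕ} (hℓ : ℓ.Prime) {N : ℕ} (hN : Odd N) :
    ∃ (K : Type) (_ : Field K) (_ : NumberField K), IsImaginaryQuadratic K ∧
      4 < (NumberField.discr K).natAbs ∧ SatisfiesHeegnerHypothesis N K ∧
      ¬ ℓ ∣ NumberField.classNumber K := by
  have h21 : Odd (21 * N) := (by decide : Odd 21).mul hN
  obtain ⟨K, iF, iN, hK, hH, hcl⟩ :=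
    BeckwithRaumRichter2024.exists_heegnerField_not_dvd_classNumber h hℓ h21
  exact ⟨K, iF, iN, hK,
    four_lt_natAbs_discr_of_satisfiesHeegnerHypothesis_twentyOne hK (hH.of_dvd (Dvd.intro N rfl)),
    hH.of_dvd (Dvd.intro_left 21 rfl), hcl⟩

/-- **KS rung (odd conductor, `K′`-form; no twist `L`-value, no biquadratic class number).** GRANTED
Beckwith–Raum–Richter 2024 Thm 1: for every CM curve `W/ℚ` of analytic rank `1` and every prime
`p ≥ 5` of inert-bad type with `N_W` ODD there is an imaginary quadratic `K′` with `|d_K′| > 4`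
(so `𝓞_K′ˣ = {±1}`), the Heegner hypothesis for `N_W` (so the bad prime `p` splits in `K′`) and
`p ∤ h(K′)` — the class-number half of the crux `HeegnerFieldSupplyCMInertBadAdm`
(stmt-BirchSwinnertonDyer-20198) in the `K′`-form, a BC5-style witness; the curve hypotheses are
carried, not used (the statement is one about `N_W` and `p` only). Signature = the route author's
sketch (planner bsd-wall-cm g5, KSRungOdd.lean). Not covered: even `N_W`, `L(W^(d_K′),1) ≠ 0`, and
`p ∤ h(K_CM·K′)`. [cite: BeckwithRaumRichter2024, Theorem 1] -/
theorem ksRung_oddConductor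
    (h : BeckwithRaumRichter2024.thm1_exists_imaginaryQuadratic_split_not_dvd_classNumber) :
    ∀ (W : WeierstrassCurve ℚ) [W.IsElliptic] [W.IsGloballyMinimal] (p : ℕ) [Fact p.Prime]
      [NeZero (W.conductorNorm ℤ)], W.HasCM → W.analyticRank = 1 → 5 ≤ p →
      Rank1Residual.CMInert W p → ¬ Rank1Residual.Good W p → Odd (W.conductorNorm ℤ) →
      ∃ (K : Type) (_ : Field K) (_ : NumberField K), IsImaginaryQuadratic K ∧
        4 < (NumberField.discr K).natAbs ∧ SatisfiesHeegnerHypothesis (W.conductorNorm ℤ) K ∧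
        ¬ p ∣ NumberField.classNumber K := by
  intro W _ _ p hp _ _ _ _ _ _ hodd
  exact exists_heegnerField_four_lt_natAbs_discr_not_dvd_classNumber h hp.out hodd

end Summit.BirchSwinnertonDyer.BirchSwinnertonDyer.Theorems.BiquadraticEisensteinDescentHeegnerFieldSupplyOddRung
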